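import Summits.BirchSwinnertonDyer.BirchSwinnertonDyer.Theorems.ResidualThetaTransportAtTwoResidualSignedLambdaLowerCMAtTwoRhoLayerPairingProjection
import HarnessLib

/-!
# K-c (conj): GALOIS INVARIANCE (P2) of the `ρ`-coefficient layer Tate pairings, and the `X`-step of the glue `locd₂`
# (`locd₂ (X • x) = Θ_g (locd₂ x) − locd₂ x`) — the `ρ`-twins of TP2's `layerPairingMod_conjMap` and `ColGlue.col_X_smul`

Route `ResidualThetaTransportAtTwo` (RTT), crux RSL_g `ResidualSignedLambdaLowerCMAtTwo` (stmt-BirchSwinnertonDyer-22608); width seat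
`bsd-wall-tp2-p2x-w2` g18 (`--supports`, closes nothing). THEOREMS ONLY (no definition, no named fact, no instance, no `sorry`). BSD is not proved
by any of this; RSL_g is not proved here. This is the residue (P2)_ρ of the v2b piece S2 `stub_plusColemanO` (STUB-PLAN rev 17 S72 / Q73; card
k3-g12): the `pair`-half of the single-step identity LIN-X `𝒸 (X • x) = X • 𝒸 x` for `𝒸 = col^{⊕r} ∘ locd₂`, whose `col`-half is the landed twist clause
of `SignedColemanImage.exists_colemanPlusHom_coeff_two_twist` (`col (z ∘ g⁻¹) = (1 + X)·col z`).

WHAT. §1 (generic finite coefficient module `M`, `g ∈ Γ_v` with image `g̃ = resGalOfEmb ι g ∈ Γ_ℚ`): `layerLocOf_conjMap`, **`layerPairingH1Of_conjMap`**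
(`⟨g · x, g · y⟩_{n,N} = ⟨x, y⟩_{n,N}`: `shapiroLift_conjMap` + `ContPairing.cupProduct_rTransHom`), `layerPairingOf_conjMap`. §2 (`ρ`):
`reduceH1CofreePkTorsion_conjMap`, `thetaSingleH1_conjMap`, `thetaLayerKummer_smul`, **`rhoLayerPairingPk_conjMap`** ((P2) mod `p^k`),
**`rhoLayerPairingAdic_conjMap`** (THE pinned `ℤ_p`-valued family), **`pair_conjMap_of_toZModPow`** (every `pair` PINNED by its residues — the binder
currency of the registered `Lines/onepair.lean`). §3 (generic `T`, `I : IwasawaH1DataCoeff T p κ γ`, any `pair` with (P2), any `locd₂` with the layer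
formula of K-c `exists_locd₂_of_layerCores`): `conjMap_layerSubgroup_eq_of_isTopGenerator`, **`locd₂_X_smul`** (`locd₂ (X • x) Q = locd₂ x (g⁻¹ • Q) − locd₂ x Q`,
from `IwasawaH1DataCoeff.proj_T_smul`), `locd₂_X_smul_single` (`Θ_g = Sprung2012.twistEnd`), and LIN-X packaged: **`col_locd₂_X_smul_single`** /
**`colTuple_locd₂_X_smul`** — for any additive `col` with the twist clause, `𝒸 (X • x) = X • 𝒸 x` where `𝒸 x = (col (locd₂ x ∘ single_i))_i`.

References: [Kobayashi2003] (8.23) (p. 18), Thm. 6.2 (6.13); [PerrinRiou1994Invent] §3.6.1; [Kato2004Asterisque] §12.2 (p. 220), §13.8 (pp. 228–229);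
[SerreLocalFields1979] VII §5 (Prop. 3); [NeukirchSchmidtWingberg2008] I §5 (1.5.3), I §6 (1.6.4); [Sprung2012] §2 (p. 1486), Def. 3.1, Def. 5.9.
-/

set_option autoImplicit false
-- the Theorems namespace of this sub repeats the summit name by design (D-0017 nested layout)
set_option linter.dupNamespace false

noncomputable section

open scoped Classical

namespace Summit.BirchSwinnertonDyer.BirchSwinnertonDyer.Theorems.ThetaTransport

open CategoryTheory Field NumberField IsDedekindDomain WeierstrassCurve
  Literature.NumberTheory.EllipticCurves Literature.NumberTheory.GaloisRepresentations
  Literature.NumberTheory.EllipticCurves.Kobayashi2003 Literature.NumberTheory.EllipticCurves.Sprung2012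
  Literature.NumberTheory.EllipticCurves.GreenbergSelmer Literature.NumberTheory.EllipticCurves.CyclotomicLayer
  Literature.NumberTheory.EllipticCurves.Kato2004
  Literature.NumberTheory.GaloisCohomology ZpExtension

attribute [local instance] absoluteGaloisGroup_compactSpace

/-! ## §1 Generic coefficients: `loc_n`, the layer pairing `⟨·,·⟩_{n,N}` and conjugation by `g ∈ Γ_v` -/

section Generic

variable {p : ℕ} [Fact p.Prime] {M : Type} [AddCommGroup M] [TopologicalSpace M] [DiscreteTopology M]
  (ρM : DiscreteGaloisModule ℚ M) (N : ℕ) [NeZero N]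
  (e : M → M → AlgebraicClosure ℚ)
  (hμ : ∀ S T, e S T ^ N = 1)
  (hadd₁ : ∀ S₁ S₂ T, e (S₁ + S₂) T = e S₁ T * e S₂ T)
  (hadd₂ : ∀ S T₁ T₂, e S (T₁ + T₂) = e S T₁ * e S T₂)
  (hgal : ∀ (σ : absoluteGaloisGroup ℚ) (S T : M), σ • e S T = e (ρM σ S) (ρM σ T))
  (κ : ZpExtension ℚ p) (v : HeightOneSpectrum (𝓞 ℚ))

omit [NeZero N] in
/-- **Localisation intertwines the conjugation actions** (generic coefficients, Literature dialect `layerLocOf`): for `g ∈ Γ_v` with image `g̃ ∈ Γ_ℚ`,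
`loc_n (g̃ · y) = g · loc_n y` (twin of TP2's `SignedKatoOffTwo.LayerPairing.layerLoc_conjMap`). [cite: SerreLocalFields1979, VII §5] -/
theorem layerLocOf_conjMap (n : ℕ) (g : absoluteGaloisGroup (v.adicCompletion ℚ)) (y : H1 ρM (κ.layerSubgroup n)) :
    layerLocOf ρM κ v n (conjMap ρM.toTopRep (κ.layerSubgroup n) (resGalOfEmb (closureEmb (K := ℚ) (v.adicCompletion ℚ)) g) 1 y) =
      (haveI := normal_layerGroup κ v n
       conjMap (localRepOf ρM v) (layerGroup κ v n) g 1 (layerLocOf ρM κ v n y)) := by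
  haveI := normal_layerGroup κ v n
  obtain ⟨φ, rfl⟩ := oneCocycleClass_surjective _ y
  unfold layerLocOf
  rw [conjMap_oneCocycleClass, map_oneCocycleClass, map_oneCocycleClass, conjMap_oneCocycleClass]
  congr 1
  apply Subtype.ext
  ext τ
  rw [contOneCocycles.pullback_apply, TopRep.hom_ofHom, conj_pullback_apply, conj_pullback_apply,
    contOneCocycles.pullback_apply, TopRep.hom_ofHom]
  have hab : subgroupConj (κ.layerSubgroup n) (resGalOfEmb (closureEmb (K := ℚ) (v.adicCompletion ℚ)) g)
        (resGalSubgroupOfEmb (κ.layerSubgroup n) (closureEmb (K := ℚ) (v.adicCompletion ℚ)) τ) =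
      resGalSubgroupOfEmb (κ.layerSubgroup n) (closureEmb (K := ℚ) (v.adicCompletion ℚ))
        (subgroupConj (layerGroup κ v n) g τ) := by
    apply Subtype.ext
    rw [subgroupConj_apply_coe, resGalSubgroupOfEmb_apply_coe, resGalSubgroupOfEmb_apply_coe, subgroupConj_apply_coe,
      map_mul, map_mul, map_inv]
  rw [hab]
  rfl

/-- **Galois invariance of the two-argument layer pairing** (generic coefficients): for `g ∈ Γ_v` and `x, y ∈ H¹(U_n, M|)`, `⟨g · x, g · y⟩_{n,N} = ⟨x, y⟩_{n,N}`:
Shapiro turns `conj_g` into the right translation by `gU_n` (`shapiroLift_conjMap`), under which the summed cup product is invariant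
(`ContPairing.cupProduct_rTransHom`). [cite: SerreLocalFields1979, VII §5] [cite: NeukirchSchmidtWingberg2008, I §5 Prop. (1.5.3)] [cite: Kobayashi2003, (8.23) (p. 18)] -/
theorem layerPairingH1Of_conjMap (n : ℕ) (g : absoluteGaloisGroup (v.adicCompletion ℚ))
    (x y : continuousCohomology 1 (subgroupRep (localRepOf ρM v) (layerGroup κ v n))) :
    haveI := normal_layerGroup κ v n
    layerPairingH1Of ρM N e hμ hadd₁ hadd₂ hgal κ v n (conjMap (localRepOf ρM v) (layerGroup κ v n) g 1 x)
        (conjMap (localRepOf ρM v) (layerGroup κ v n) g 1 y) =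
      layerPairingH1Of ρM N e hμ hadd₁ hadd₂ hgal κ v n x y := by
  haveI := normal_layerGroup κ v n
  letI : Fintype (absoluteGaloisGroup (v.adicCompletion ℚ) ⧸ layerGroup κ v n) := layerFintypeQuot κ v n
  rw [layerPairingH1Of_apply, layerPairingH1Of_apply]
  unfold layerShapiroOf layerSumPairingOf
  rw [shapiroLift_conjMap, shapiroLift_conjMap, ContPairing.cupProduct_rTransHom, cohomologyMap_id_muLocalRep']

/-- **(P2) modulo `N`, generic coefficients, global first argument**: `⟨loc_n (g̃ · x), g · y⟩_{n,N} = ⟨loc_n x, y⟩_{n,N}` for `x ∈ H¹(Γ_n, M)`,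
`y ∈ H¹(U_n, M|)`, `g ∈ Γ_v` (`layerLocOf_conjMap` + `layerPairingH1Of_conjMap`). [cite: Kobayashi2003, (8.23) (p. 18)] [cite: SerreLocalFields1979, VII §5] -/
theorem layerPairingOf_conjMap (n : ℕ) (g : absoluteGaloisGroup (v.adicCompletion ℚ)) (x : H1 ρM (κ.layerSubgroup n))
    (y : continuousCohomology 1 (subgroupRep (localRepOf ρM v) (layerGroup κ v n))) :
    haveI := normal_layerGroup κ v n
    layerPairingOf ρM N e hμ hadd₁ hadd₂ hgal κ v n
        (conjMap ρM.toTopRep (κ.layerSubgroup n) (resGalOfEmb (closureEmb (K := ℚ) (v.adicCompletion ℚ)) g) 1 x)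
        (conjMap (localRepOf ρM v) (layerGroup κ v n) g 1 y) =
      layerPairingOf ρM N e hμ hadd₁ hadd₂ hgal κ v n x y := by
  haveI := normal_layerGroup κ v n
  rw [layerPairingOf_apply, layerPairingOf_apply, layerLocOf_conjMap, layerPairingH1Of_conjMap]

end Generic

/-! ## §2 `ρ`: reduction, Θ-Kummer classes, and (P2) for `rhoLayerPairingPk` / `rhoLayerPairingAdic` / every pinned `pair` -/

section Rho

variable {p : ℕ} [Fact p.Prime] (S : Set (PadicAlgCl p)) {d : ℕ} (ρ : FramedGaloisRep ℚ ↥(padicCoeffIntegers S) d) (k : ℕ)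

/-- **`red_{p^k} ∘ conj_g̃ = conj_g̃ ∘ red_{p^k}`** on `H¹(U, ·)`, `U ⊴ Γ_ℚ`: the reduction `T_ρ → A_ρ[p^k]` is `Γ_ℚ`-equivariant (`divPowCofreeMk_smul`,
`mapH1AddHom_conjMap`; dialect `discreteTopRep_cofreeTorsionBy_eq`). [cite: Kato2004Asterisque, §13.8 (p. 228)] [cite: NeukirchSchmidtWingberg2008, I §5] -/
theorem reduceH1CofreePkTorsion_conjMap (U : Subgroup (absoluteGaloisGroup ℚ)) [U.Normal] (σ : absoluteGaloisGroup ℚ)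
    (c : H1 (FramedGaloisRep.toGaloisRep ρ) U) :
    (reduceH1CofreePkTorsion S ρ k U (conjMap (FramedGaloisRep.toGaloisRep ρ).toTopRep U σ 1 c) :
        H1 (cofreeTorsionGaloisModule S ρ ((p ^ k : ℕ) : ℤ)) U) =
      conjMap (cofreeTorsionGaloisModule S ρ ((p ^ k : ℕ) : ℤ)).toTopRep U σ 1
        (reduceH1CofreePkTorsion S ρ k U c : H1 (cofreeTorsionGaloisModule S ρ ((p ^ k : ℕ) : ℤ)) U) :=
  mapH1AddHom_conjMap (X := (FramedGaloisRep.toGaloisRep ρ).toTopRep) (Y := (cofreeTorsionGaloisModule S ρ ((p ^ k : ℕ) : ℤ)).toTopRep)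
    (divPowCofreeMkTorsion S ρ k) (continuous_divPowCofreeMkTorsion S ρ k) (fun g t => Subtype.ext (divPowCofreeMk_smul S ρ k g t)) σ
    (divPowCofreeMkTorsion_subgroupRep S ρ k U) c

variable (W : WeierstrassCurve ℚ) {r : ℕ} (Θ : Cofree ρ ↥(padicCoeffField S) ≃+ (Fin r → ↥(W.geomPrimaryTorsion p))) (κ : ZpExtension ℚ p)
  (v : HeightOneSpectrum (𝓞 ℚ))
  (hΘ : ∀ (δ : absoluteGaloisGroup (v.adicCompletion ℚ)) (m : Cofree ρ ↥(padicCoeffField S)) (i : Fin r),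
    Θ (resGalOfEmb (closureEmb (K := ℚ) (v.adicCompletion ℚ)) δ • m) i =
      resGalOfEmb (closureEmb (K := ℚ) (v.adicCompletion ℚ)) δ • Θ m i)

/-- `(thetaSingle i)_*` commutes with the conjugation action of `g ∈ Γ_v` on `H¹(U_n, ·)` (`thetaSingle i` is `Γ_v`-equivariant under `hΘ`, `thetaSingle_smul`;
`mapH1AddHom_conjMap`). [cite: SerreGaloisCohomology1997, I §2.2] [cite: NeukirchSchmidtWingberg2008, I §5] -/
theorem thetaSingleH1_conjMap (i : Fin r) (n : ℕ) (g : absoluteGaloisGroup (v.adicCompletion ℚ))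
    (c : continuousCohomology 1 (subgroupRep (torsionLocalRep W (p ^ k) v) (layerGroup κ v n))) :
    haveI := normal_layerGroup κ v n
    thetaSingleH1 S ρ k W Θ κ v hΘ i n (conjMap (torsionLocalRep W (p ^ k) v) (layerGroup κ v n) g 1 c) =
      conjMap (cofreeTorsionLocalRep S ρ ((p ^ k : ℕ) : ℤ) v) (layerGroup κ v n) g 1 (thetaSingleH1 S ρ k W Θ κ v hΘ i n c) := by
  haveI := normal_layerGroup κ v n
  unfold thetaSingleH1
  exact mapH1AddHom_conjMap (X := torsionLocalRep W (p ^ k) v) (Y := cofreeTorsionLocalRep S ρ ((p ^ k : ℕ) : ℤ) v) _ _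
    (fun δ P => thetaSingle_smul ρ p k W Θ v hΘ i δ P) g _ c

variable [W.IsElliptic]

/-- **The layer Kummer map is `Γ_v`-equivariant** (Literature dialect `CyclotomicLayer.layerKummer`): `κ_{U_n}(g • Q) = g · κ_{U_n}(Q)` — TP2's
`SignedKatoOffTwo.LayerPairing.layerKummer_smul` read through the two dialects' parallel bodies. [cite: Kobayashi2003, (8.23) (p. 18)] -/
theorem layerKummer'_smul (N : ℕ) [NeZero N] (n : ℕ) (g : absoluteGaloisGroup (v.adicCompletion ℚ)) (Q : localPoints W (v.adicCompletion ℚ))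
    (hQ : Q ∈ localLayerPointsOfEmb κ (closureEmb (K := ℚ) (v.adicCompletion ℚ)) W n) :
    haveI := normal_layerGroup κ v n
    layerKummer W N κ v n ⟨g • Q, smul_mem_localLayerPointsOfEmb κ (closureEmb (K := ℚ) (v.adicCompletion ℚ)) W n g hQ⟩ =
      conjMap (torsionLocalRep W N v) (layerGroup κ v n) g 1 (layerKummer W N κ v n ⟨Q, hQ⟩) :=
  SignedKatoOffTwo.LayerPairing.layerKummer_smul W N κ v n g Q hQ

/-- **The Θ-Kummer classes are `Γ_v`-equivariant**: `thetaLayerKummer (g • Q) = g · thetaLayerKummer Q` for an `r`-tuple `Q` of layer points and `g ∈ Γ_v`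
(coordinatewise `layerKummer'_smul` + `thetaSingleH1_conjMap`, additivity of `conjMap`). [cite: Kobayashi2003, (8.23) (p. 18)] [cite: SerreLocalFields1979, VII §5] -/
theorem thetaLayerKummer_smul (n : ℕ) (g : absoluteGaloisGroup (v.adicCompletion ℚ)) (Q : Fin r → localPoints W (v.adicCompletion ℚ))
    (hQ : ∀ i, Q i ∈ localLayerPointsOfEmb κ (closureEmb (K := ℚ) (v.adicCompletion ℚ)) W n) :
    haveI : NeZero (p ^ k) := ⟨pow_ne_zero k (Fact.out : p.Prime).ne_zero⟩
    haveI := normal_layerGroup κ v n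
    thetaLayerKummer S ρ k W Θ κ v hΘ n
        (fun i => ⟨g • Q i, smul_mem_localLayerPointsOfEmb κ (closureEmb (K := ℚ) (v.adicCompletion ℚ)) W n g (hQ i)⟩) =
      conjMap (cofreeTorsionLocalRep S ρ ((p ^ k : ℕ) : ℤ) v) (layerGroup κ v n) g 1
        (thetaLayerKummer S ρ k W Θ κ v hΘ n (fun i => ⟨Q i, hQ i⟩)) := by
  haveI : NeZero (p ^ k) := ⟨pow_ne_zero k (Fact.out : p.Prime).ne_zero⟩
  haveI := normal_layerGroup κ v n
  rw [thetaLayerKummer_apply, thetaLayerKummer_apply, map_sum]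
  refine Finset.sum_congr rfl fun i _ => ?_
  rw [← thetaSingleH1_conjMap, ← layerKummer'_smul W κ v (p ^ k) n g (Q i) (hQ i)]

variable (ePk : ∀ k : ℕ, ↥(AddSubgroup.torsionBy (Cofree ρ ↥(padicCoeffField S)) ((p ^ k : ℕ) : ℤ)) →
    ↥(AddSubgroup.torsionBy (Cofree ρ ↥(padicCoeffField S)) ((p ^ k : ℕ) : ℤ)) → AlgebraicClosure ℚ)
  (hμPk : ∀ k a b, ePk k a b ^ (p ^ k) = 1)
  (hadd₁Pk : ∀ k a₁ a₂ b, ePk k (a₁ + a₂) b = ePk k a₁ b * ePk k a₂ b)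
  (hadd₂Pk : ∀ k a b₁ b₂, ePk k a (b₁ + b₂) = ePk k a b₁ * ePk k a b₂)
  (hgalPk : ∀ k (σ : absoluteGaloisGroup ℚ) (a b : ↥(AddSubgroup.torsionBy (Cofree ρ ↥(padicCoeffField S)) ((p ^ k : ℕ) : ℤ))),
    σ • ePk k a b = ePk k (cofreeTorsionGaloisModule S ρ _ σ a) (cofreeTorsionGaloisModule S ρ _ σ b))

set_option maxHeartbeats 3200000 in
-- the dialect bridges `subgroupH1 U ↥A_ρ[p^k] = H1 (cofreeTorsionGaloisModule …) U` are slow to unify under `rw` (instance paths of the torsion subtype; as in p676533 / K-c)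
/-- **(P2) modulo `p^k` — GALOIS INVARIANCE of the `ρ`-coefficient layer Tate pairings**: for `g ∈ Γ_v` with image `g̃ ∈ Γ_ℚ`, `y ∈ H¹(Γ_n, T_ρ)`,
`Q ∈ E(ℚ_{n,v})^r`: `rhoLayerPairingPk n k (g̃ · y) (g • Q) = rhoLayerPairingPk n k y Q` (`reduceH1CofreePkTorsion_conjMap`, `layerLocOf_conjMap`, `thetaLayerKummer_smul`,
`layerPairingH1Of_conjMap`; the `ρ`-twin of TP2's `layerPairingMod_conjMap`). [cite: Kobayashi2003, (8.23) (p. 18)] [cite: Kato2004Asterisque, §13.8 (pp. 228–229)] -/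
theorem rhoLayerPairingPk_conjMap (n : ℕ) (g : absoluteGaloisGroup (v.adicCompletion ℚ))
    (y : H1 (FramedGaloisRep.toGaloisRep ρ) (κ.layerSubgroup n)) (Q : Fin r → localPoints W (v.adicCompletion ℚ))
    (hQ : ∀ i, Q i ∈ localLayerPointsOfEmb κ (closureEmb (K := ℚ) (v.adicCompletion ℚ)) W n) :
    rhoLayerPairingPk S ρ W ePk hμPk hadd₁Pk hadd₂Pk hgalPk Θ κ v hΘ n k
        (conjMap (FramedGaloisRep.toGaloisRep ρ).toTopRep (κ.layerSubgroup n) (resGalOfEmb (closureEmb (K := ℚ) (v.adicCompletion ℚ)) g) 1 y)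
        (fun i => ⟨g • Q i, smul_mem_localLayerPointsOfEmb κ (closureEmb (K := ℚ) (v.adicCompletion ℚ)) W n g (hQ i)⟩) =
      rhoLayerPairingPk S ρ W ePk hμPk hadd₁Pk hadd₂Pk hgalPk Θ κ v hΘ n k y (fun i => ⟨Q i, hQ i⟩) := by
  haveI : NeZero (p ^ k) := ⟨pow_ne_zero k (Fact.out : p.Prime).ne_zero⟩
  haveI := normal_layerGroup κ v n
  rw [rhoLayerPairingPk_apply, rhoLayerPairingPk_apply]
  change layerPairingH1Of _ (p ^ k) (ePk k) (hμPk k) (hadd₁Pk k) (hadd₂Pk k) (hgalPk k) κ v n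
      (layerLocOf (cofreeTorsionGaloisModule S ρ ((p ^ k : ℕ) : ℤ)) κ v n
        (reduceH1CofreePkTorsion S ρ k (κ.layerSubgroup n)
          (conjMap (FramedGaloisRep.toGaloisRep ρ).toTopRep (κ.layerSubgroup n) (resGalOfEmb (closureEmb (K := ℚ) (v.adicCompletion ℚ)) g) 1 y) :
          H1 (cofreeTorsionGaloisModule S ρ ((p ^ k : ℕ) : ℤ)) (κ.layerSubgroup n)))
      (thetaLayerKummer S ρ k W Θ κ v hΘ n fun i =>
        ⟨g • Q i, smul_mem_localLayerPointsOfEmb κ (closureEmb (K := ℚ) (v.adicCompletion ℚ)) W n g (hQ i)⟩) = _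
  rw [reduceH1CofreePkTorsion_conjMap, layerLocOf_conjMap, thetaLayerKummer_smul, layerPairingH1Of_conjMap]

/-- **(P2) for THE pinned `ℤ_p`-valued family**: `rhoLayerPairingAdic n (g̃ · y) (g • Q) = rhoLayerPairingAdic n y Q` (residue-wise from
`rhoLayerPairingPk_conjMap`, `rhoLayerPairingAdic_apply_eq_of_forall`). [cite: PerrinRiou1994Invent, §3.6.1] [cite: Kobayashi2003, (8.23) (p. 18)] -/
theorem rhoLayerPairingAdic_conjMap (n : ℕ)
    (hcompat : ∀ (k : ℕ) (x : H1 (FramedGaloisRep.toGaloisRep ρ) (κ.layerSubgroup n))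
      (Q : Fin r → localLayerPointsOfEmb κ (closureEmb (K := ℚ) (v.adicCompletion ℚ)) W n),
      (ZMod.cast (rhoLayerPairingPk S ρ W ePk hμPk hadd₁Pk hadd₂Pk hgalPk Θ κ v hΘ n (k + 1) x Q) : ZMod (p ^ k)) =
        rhoLayerPairingPk S ρ W ePk hμPk hadd₁Pk hadd₂Pk hgalPk Θ κ v hΘ n k x Q)
    (g : absoluteGaloisGroup (v.adicCompletion ℚ)) (y : H1 (FramedGaloisRep.toGaloisRep ρ) (κ.layerSubgroup n))
    (Q : Fin r → localPoints W (v.adicCompletion ℚ))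
    (hQ : ∀ i, Q i ∈ localLayerPointsOfEmb κ (closureEmb (K := ℚ) (v.adicCompletion ℚ)) W n) :
    rhoLayerPairingAdic S ρ W ePk hμPk hadd₁Pk hadd₂Pk hgalPk Θ κ v hΘ n hcompat
        (conjMap (FramedGaloisRep.toGaloisRep ρ).toTopRep (κ.layerSubgroup n) (resGalOfEmb (closureEmb (K := ℚ) (v.adicCompletion ℚ)) g) 1 y)
        (fun i => ⟨g • Q i, smul_mem_localLayerPointsOfEmb κ (closureEmb (K := ℚ) (v.adicCompletion ℚ)) W n g (hQ i)⟩) =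
      rhoLayerPairingAdic S ρ W ePk hμPk hadd₁Pk hadd₂Pk hgalPk Θ κ v hΘ n hcompat y (fun i => ⟨Q i, hQ i⟩) :=
  rhoLayerPairingAdic_apply_eq_of_forall S ρ W ePk hμPk hadd₁Pk hadd₂Pk hgalPk Θ κ v hΘ n hcompat fun k =>
    rhoLayerPairingPk_conjMap S ρ k W Θ κ v hΘ ePk hμPk hadd₁Pk hadd₂Pk hgalPk n g y Q hQ

/-- **(P2) for EVERY `ℤ_p`-valued family PINNED by its residues** (the `pair` binder of the registered `Lines/onepair.lean`: `toZModPow k (pair m x Q) =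
rhoLayerPairingPk … m k x Q`): `pair n (g̃ · y) (g • Q) = pair n y Q` (`ℤ_p` is `p`-adically separated, `PadicInt.ext_of_toZModPow`).
[cite: PerrinRiou1994Invent, §3.6.1] [cite: Kobayashi2003, (8.23) (p. 18)] -/
theorem pair_conjMap_of_toZModPow
    (pair : ∀ n : ℕ, H1 (FramedGaloisRep.toGaloisRep ρ) (κ.layerSubgroup n) →+
      ((Fin r → localLayerPointsOfEmb κ (closureEmb (K := ℚ) (v.adicCompletion ℚ)) W n) →+ ℤ_[p]))
    (hpair : ∀ (n k : ℕ) (x : H1 (FramedGaloisRep.toGaloisRep ρ) (κ.layerSubgroup n))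
      (Q : Fin r → localLayerPointsOfEmb κ (closureEmb (K := ℚ) (v.adicCompletion ℚ)) W n),
      PadicInt.toZModPow k (pair n x Q) = rhoLayerPairingPk S ρ W ePk hμPk hadd₁Pk hadd₂Pk hgalPk Θ κ v hΘ n k x Q)
    (n : ℕ) (g : absoluteGaloisGroup (v.adicCompletion ℚ)) (y : H1 (FramedGaloisRep.toGaloisRep ρ) (κ.layerSubgroup n))
    (Q : Fin r → localPoints W (v.adicCompletion ℚ))
    (hQ : ∀ i, Q i ∈ localLayerPointsOfEmb κ (closureEmb (K := ℚ) (v.adicCompletion ℚ)) W n) :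
    pair n (conjMap (FramedGaloisRep.toGaloisRep ρ).toTopRep (κ.layerSubgroup n) (resGalOfEmb (closureEmb (K := ℚ) (v.adicCompletion ℚ)) g) 1 y)
        (fun i => ⟨g • Q i, smul_mem_localLayerPointsOfEmb κ (closureEmb (K := ℚ) (v.adicCompletion ℚ)) W n g (hQ i)⟩) =
      pair n y (fun i => ⟨Q i, hQ i⟩) :=
  PadicInt.ext_of_toZModPow.mp fun k => by
    rw [hpair, hpair, rhoLayerPairingPk_conjMap S ρ k W Θ κ v hΘ ePk hμPk hadd₁Pk hadd₂Pk hgalPk n g y Q hQ]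

end Rho

/-! ## §3 The `X`-step of the glue: `locd₂ (X • x) = Θ_g (locd₂ x) − locd₂ x` from (P2) and `proj_T_smul` -/

section Glue

variable {p : ℕ} [Fact p.Prime] {A : Type} [CommRing A] [TopologicalSpace A] {M : Type} [AddCommGroup M] [Module A M]
  [TopologicalSpace M] [IsTopologicalAddGroup M] [ContinuousSMul A M] {T : GaloisRep ℚ A M}
  {κ : ZpExtension ℚ p} {γ : absoluteGaloisGroup ℚ} (I : IwasawaH1DataCoeff T p κ γ)
  (W : WeierstrassCurve ℚ) (v : HeightOneSpectrum (𝓞 ℚ)) {r : ℕ}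
  {pair : ∀ n : ℕ, H1 T (κ.layerSubgroup n) →+
    ((Fin r → localLayerPointsOfEmb κ (closureEmb (K := ℚ) (v.adicCompletion ℚ)) W n) →+ ℤ_[p])}
  {locd₂ : I.H →+ ((Fin r → localTowerPointsOfEmb κ (closureEmb (K := ℚ) (v.adicCompletion ℚ)) W) →+ ℤ_[p])}
  {g : absoluteGaloisGroup (v.adicCompletion ℚ)}

/-- `conj_γ = conj_{res g}` on `H¹(Γ_n, T)` when `κ γ = 1 = κ (res g)`: they differ by `(res g)⁻¹ γ ∈ ker κ ≤ Γ_n`, acting trivially (`conjMap_eq_self_of_mem_one`);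
coefficient-generic twin of TP2's `ColGlue.conjMap_eq_conjMap_resGalOfEmb`. [cite: SerreLocalFields1979, VII §5 Prop. 3] -/
theorem conjMap_layerSubgroup_eq_of_isTopGenerator (hγ : κ.IsTopGenerator γ)
    (hg : κ.IsTopGenerator (resGalOfEmb (closureEmb (K := ℚ) (v.adicCompletion ℚ)) g)) (n : ℕ) (y : H1 T (κ.layerSubgroup n)) :
    conjMap T.toTopRep (κ.layerSubgroup n) γ 1 y =
      conjMap T.toTopRep (κ.layerSubgroup n) (resGalOfEmb (closureEmb (K := ℚ) (v.adicCompletion ℚ)) g) 1 y := by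
  have hmem : (resGalOfEmb (closureEmb (K := ℚ) (v.adicCompletion ℚ)) g)⁻¹ * γ ∈ κ.layerSubgroup n := by
    refine κ.kerSubgroup_le_layerSubgroup n ?_
    rw [mem_kerSubgroup, map_mul, map_inv]
    change (κ (resGalOfEmb (closureEmb (K := ℚ) (v.adicCompletion ℚ)) g))⁻¹ * κ γ = 1
    rw [show κ (resGalOfEmb (closureEmb (K := ℚ) (v.adicCompletion ℚ)) g) = Multiplicative.ofAdd 1 from hg,
      show κ γ = Multiplicative.ofAdd 1 from hγ, inv_mul_cancel]
  conv_lhs => rw [show γ = resGalOfEmb (closureEmb (K := ℚ) (v.adicCompletion ℚ)) g *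
    ((resGalOfEmb (closureEmb (K := ℚ) (v.adicCompletion ℚ)) g)⁻¹ * γ) by group]
  rw [← conjMap_conjMap, conjMap_eq_self_of_mem_one _ _ hmem]

variable (hγ : κ.IsTopGenerator γ) (hg : κ.IsTopGenerator (resGalOfEmb (closureEmb (K := ℚ) (v.adicCompletion ℚ)) g))
  (hP2 : ∀ (n : ℕ) (y : H1 T (κ.layerSubgroup n)) (Q : Fin r → localPoints W (v.adicCompletion ℚ))
    (hQ : ∀ i, Q i ∈ localLayerPointsOfEmb κ (closureEmb (K := ℚ) (v.adicCompletion ℚ)) W n),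
    pair n (conjMap T.toTopRep (κ.layerSubgroup n) (resGalOfEmb (closureEmb (K := ℚ) (v.adicCompletion ℚ)) g) 1 y)
        (fun i => ⟨g • Q i, smul_mem_localLayerPointsOfEmb κ (closureEmb (K := ℚ) (v.adicCompletion ℚ)) W n g (hQ i)⟩) =
      pair n y (fun i => ⟨Q i, hQ i⟩))
  (hlocd : ∀ (n : ℕ) (x : I.H) (Q : Fin r → localPoints W (v.adicCompletion ℚ))
    (hQ : ∀ i, Q i ∈ localLayerPointsOfEmb κ (closureEmb (K := ℚ) (v.adicCompletion ℚ)) W n),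
    locd₂ x (fun i => ⟨Q i, localLayerPointsOfEmb_le_localTowerPointsOfEmb κ _ W n (hQ i)⟩) = pair n (I.proj n x) (fun i => ⟨Q i, hQ i⟩))

include hγ hg hP2 hlocd in
/-- **The `X`-step at a layer**: for a tuple `Q` of points of `E(ℚ_{n,v})`, `locd₂ (X • x) Q = locd₂ x (g⁻¹ • Q) − locd₂ x Q` — `X = conj_γ − 1`
(`IwasawaH1DataCoeff.proj_T_smul`), `conj_γ = conj_{res g}` (`conjMap_layerSubgroup_eq_of_isTopGenerator`), and (P2) turns `conj_{res g}` into `Q ↦ g⁻¹ • Q`; the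
`ρ`/tuple twin of TP2's `ColGlue.col_X_smul`. [cite: Kato2004Asterisque, §12.2 (p. 220)] [cite: Sprung2012, Def. 3.1 (p. 1489)] [cite: PerrinRiou1994Invent, §3.6.1] -/
theorem locd₂_X_smul_of_mem (n : ℕ) (x : I.H) (Q : Fin r → localPoints W (v.adicCompletion ℚ))
    (hQ : ∀ i, Q i ∈ localLayerPointsOfEmb κ (closureEmb (K := ℚ) (v.adicCompletion ℚ)) W n) :
    locd₂ ((PowerSeries.X : PowerSeries A) • x) (fun i => ⟨Q i, localLayerPointsOfEmb_le_localTowerPointsOfEmb κ _ W n (hQ i)⟩) =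
      locd₂ x (fun i => ⟨g⁻¹ • Q i, localLayerPointsOfEmb_le_localTowerPointsOfEmb κ _ W n
          (smul_mem_localLayerPointsOfEmb κ (closureEmb (K := ℚ) (v.adicCompletion ℚ)) W n g⁻¹ (hQ i))⟩) -
        locd₂ x (fun i => ⟨Q i, localLayerPointsOfEmb_le_localTowerPointsOfEmb κ _ W n (hQ i)⟩) := by
  have hgQ : ∀ i, g⁻¹ • Q i ∈ localLayerPointsOfEmb κ (closureEmb (K := ℚ) (v.adicCompletion ℚ)) W n := fun i =>
    smul_mem_localLayerPointsOfEmb κ (closureEmb (K := ℚ) (v.adicCompletion ℚ)) W n g⁻¹ (hQ i)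
  rw [hlocd n _ Q hQ, hlocd n x _ hgQ, hlocd n x Q hQ, I.proj_T_smul, map_sub, AddMonoidHom.sub_apply,
    conjMap_layerSubgroup_eq_of_isTopGenerator v hγ hg]
  congr 1
  -- invariance at the tuple `g⁻¹ • Q`: `pair n (conj_{res g} y) (g • g⁻¹ • Q) = pair n y (g⁻¹ • Q)`
  have h := hP2 n (I.proj n x) (fun i => g⁻¹ • Q i) hgQ
  have e : (fun i => (⟨g • g⁻¹ • Q i, smul_mem_localLayerPointsOfEmb κ (closureEmb (K := ℚ) (v.adicCompletion ℚ)) W n g (hgQ i)⟩ :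
      localLayerPointsOfEmb κ (closureEmb (K := ℚ) (v.adicCompletion ℚ)) W n)) = fun i => ⟨Q i, hQ i⟩ :=
    funext fun i => Subtype.ext (smul_inv_smul g (Q i))
  rw [e] at h
  exact h

include hγ hg hP2 hlocd in
/-- **The `X`-step on tower tuples: `locd₂ (X • x) Q = locd₂ x (g⁻¹ • Q) − locd₂ x Q`** for every `x ∈ 𝐇¹_Γ(T)` and every tuple `Q` of points of `E(ℚ_{∞,v})`
(read at a common layer, `exists_common_layer`). [cite: Kato2004Asterisque, §12.2 (p. 220)] [cite: Sprung2012, Def. 3.1 (p. 1489)] [cite: PerrinRiou1994Invent, §3.6.1] -/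
theorem locd₂_X_smul (x : I.H) (Q : Fin r → localTowerPointsOfEmb κ (closureEmb (K := ℚ) (v.adicCompletion ℚ)) W) :
    locd₂ ((PowerSeries.X : PowerSeries A) • x) Q =
      locd₂ x (fun i => ⟨g⁻¹ • (Q i : localPoints W (v.adicCompletion ℚ)),
          smul_mem_localTowerPointsOfEmb κ (closureEmb (K := ℚ) (v.adicCompletion ℚ)) W g⁻¹ (Q i).2⟩) - locd₂ x Q := by
  obtain ⟨n, hn⟩ := exists_common_layer W v Q
  have h := locd₂_X_smul_of_mem I W v hγ hg hP2 hlocd n x (fun i => (Q i : localPoints W (v.adicCompletion ℚ))) hn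
  have e₁ : (fun i => (⟨(Q i : localPoints W (v.adicCompletion ℚ)),
      localLayerPointsOfEmb_le_localTowerPointsOfEmb κ _ W n (hn i)⟩ : localTowerPointsOfEmb κ (closureEmb (K := ℚ) (v.adicCompletion ℚ)) W)) = Q :=
    funext fun i => Subtype.ext rfl
  have e₂ : (fun i => (⟨g⁻¹ • (Q i : localPoints W (v.adicCompletion ℚ)), localLayerPointsOfEmb_le_localTowerPointsOfEmb κ _ W n
      (smul_mem_localLayerPointsOfEmb κ (closureEmb (K := ℚ) (v.adicCompletion ℚ)) W n g⁻¹ (hn i))⟩ :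
        localTowerPointsOfEmb κ (closureEmb (K := ℚ) (v.adicCompletion ℚ)) W)) =
      fun i => ⟨g⁻¹ • (Q i : localPoints W (v.adicCompletion ℚ)),
        smul_mem_localTowerPointsOfEmb κ (closureEmb (K := ℚ) (v.adicCompletion ℚ)) W g⁻¹ (Q i).2⟩ :=
    funext fun i => Subtype.ext rfl
  rw [e₁, e₂] at h
  exact h

/-- `g • (Q·δ_i) = (g • Q)·δ_i` for a tuple of tower points supported in one coordinate (`g • 0 = 0`). [cite: Sprung2012, §2 (p. 1486)] -/
theorem smul_pi_single_localTowerPointsOfEmb (σ : absoluteGaloisGroup (v.adicCompletion ℚ)) (i : Fin r)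
    (a : localTowerPointsOfEmb κ (closureEmb (K := ℚ) (v.adicCompletion ℚ)) W) :
    (fun j => (⟨σ • ((Pi.single i a : Fin r → localTowerPointsOfEmb κ (closureEmb (K := ℚ) (v.adicCompletion ℚ)) W) j :
        localPoints W (v.adicCompletion ℚ)), smul_mem_localTowerPointsOfEmb κ (closureEmb (K := ℚ) (v.adicCompletion ℚ)) W σ
          ((Pi.single i a : Fin r → localTowerPointsOfEmb κ (closureEmb (K := ℚ) (v.adicCompletion ℚ)) W) j).2⟩ :
        localTowerPointsOfEmb κ (closureEmb (K := ℚ) (v.adicCompletion ℚ)) W)) =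
      Pi.single i ⟨σ • (a : localPoints W (v.adicCompletion ℚ)), smul_mem_localTowerPointsOfEmb κ (closureEmb (K := ℚ) (v.adicCompletion ℚ)) W σ a.2⟩ := by
  funext j
  by_cases hj : j = i
  · subst hj
    simp only [Pi.single_eq_same]
  · rw [Pi.single_eq_of_ne hj, Pi.single_eq_of_ne hj]
    exact Subtype.ext (smul_zero σ)

include hγ hg hP2 hlocd in
/-- **The `X`-step, coordinate form**: `locd₂ (X • x) ∘ single_i = Θ_g (locd₂ x ∘ single_i) − locd₂ x ∘ single_i`, `Θ_g z = z ∘ g⁻¹` (`Sprung2012.twistEnd`) — the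
functionals `locd₂ x ∘ single_i` are the coordinates of `𝒸` in the registered `Lines/onepair.lean`. [cite: Sprung2012, Def. 3.1 (p. 1489)] [cite: Kato2004Asterisque, §12.2 (p. 220)] -/
theorem locd₂_X_smul_single (x : I.H) (i : Fin r) :
    (locd₂ ((PowerSeries.X : PowerSeries A) • x)).comp
        (AddMonoidHom.single (fun _ : Fin r => ↥(localTowerPointsOfEmb κ (closureEmb (K := ℚ) (v.adicCompletion ℚ)) W)) i) =
      twistEnd κ (closureEmb (K := ℚ) (v.adicCompletion ℚ)) W g
          ((locd₂ x).comp (AddMonoidHom.single (fun _ : Fin r => ↥(localTowerPointsOfEmb κ (closureEmb (K := ℚ) (v.adicCompletion ℚ)) W)) i)) -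
        (locd₂ x).comp (AddMonoidHom.single (fun _ : Fin r => ↥(localTowerPointsOfEmb κ (closureEmb (K := ℚ) (v.adicCompletion ℚ)) W)) i) := by
  refine AddMonoidHom.ext fun a => ?_
  rw [AddMonoidHom.sub_apply, AddMonoidHom.comp_apply, AddMonoidHom.comp_apply, twistEnd_apply, AddMonoidHom.comp_apply,
    AddMonoidHom.single_apply, AddMonoidHom.single_apply, locd₂_X_smul I W v hγ hg hP2 hlocd,
    smul_pi_single_localTowerPointsOfEmb]

include hγ hg hP2 hlocd in
/-- **LIN-X for `𝒸 = col^{⊕r} ∘ locd₂`, one coordinate**: for ANY additive `col : Hom(E(ℚ_{∞,v}), ℤ_p) → O⟦X⟧` with the twist clause `col (z ∘ g⁻¹) = (1 + X)·col z`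
(`SignedColemanImage.exists_colemanPlusHom_coeff_two_twist`), `col (locd₂ (X • x) ∘ single_i) = X · col (locd₂ x ∘ single_i)`.
[cite: Kobayashi2003, Thm. 6.2 (6.13) (p. 12), §8 (8.20)–(8.23)] [cite: Sprung2012, Def. 5.9 (p. 1495)] [cite: Kato2004Asterisque, §12.2 (p. 220)] -/
theorem col_locd₂_X_smul_single {O : Type*} [CommRing O]
    (col : (localTowerPointsOfEmb κ (closureEmb (K := ℚ) (v.adicCompletion ℚ)) W →+ ℤ_[p]) →+ PowerSeries O)
    (hcol : ∀ z z' : localTowerPointsOfEmb κ (closureEmb (K := ℚ) (v.adicCompletion ℚ)) W →+ ℤ_[p],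
      (∀ a : localTowerPointsOfEmb κ (closureEmb (K := ℚ) (v.adicCompletion ℚ)) W,
        z' a = z ⟨g⁻¹ • (a : localPoints W (v.adicCompletion ℚ)), smul_mem_localTowerPointsOfEmb κ _ W g⁻¹ a.2⟩) →
      col z' = (1 + PowerSeries.X) * col z)
    (x : I.H) (i : Fin r) :
    col ((locd₂ ((PowerSeries.X : PowerSeries A) • x)).comp
        (AddMonoidHom.single (fun _ : Fin r => ↥(localTowerPointsOfEmb κ (closureEmb (K := ℚ) (v.adicCompletion ℚ)) W)) i)) =
      PowerSeries.X * col ((locd₂ x).comp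
        (AddMonoidHom.single (fun _ : Fin r => ↥(localTowerPointsOfEmb κ (closureEmb (K := ℚ) (v.adicCompletion ℚ)) W)) i)) := by
  rw [locd₂_X_smul_single I W v hγ hg hP2 hlocd, map_sub, hcol _ _ (fun a => twistEnd_apply _ _ _ g _ a)]
  ring

include hγ hg hP2 hlocd in
/-- **LIN-X for `𝒸 = col^{⊕r} ∘ locd₂`: `𝒸 (X • x) = X • 𝒸 x` in `O⟦X⟧^r`** (card k3-g12 / STUB-PLAN rev 17 S72, piece S2; `pair`-half = (P2)
`pair_conjMap_of_toZModPow`, `col`-half = the twist clause). [cite: Kobayashi2003, Thm. 6.2 (6.13) (p. 12)] [cite: Kato2004Asterisque, §12.2 (p. 220)] -/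
theorem colTuple_locd₂_X_smul {O : Type*} [CommRing O]
    (col : (localTowerPointsOfEmb κ (closureEmb (K := ℚ) (v.adicCompletion ℚ)) W →+ ℤ_[p]) →+ PowerSeries O)
    (hcol : ∀ z z' : localTowerPointsOfEmb κ (closureEmb (K := ℚ) (v.adicCompletion ℚ)) W →+ ℤ_[p],
      (∀ a : localTowerPointsOfEmb κ (closureEmb (K := ℚ) (v.adicCompletion ℚ)) W,
        z' a = z ⟨g⁻¹ • (a : localPoints W (v.adicCompletion ℚ)), smul_mem_localTowerPointsOfEmb κ _ W g⁻¹ a.2⟩) →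
      col z' = (1 + PowerSeries.X) * col z)
    (x : I.H) :
    (fun i : Fin r => col ((locd₂ ((PowerSeries.X : PowerSeries A) • x)).comp
        (AddMonoidHom.single (fun _ : Fin r => ↥(localTowerPointsOfEmb κ (closureEmb (K := ℚ) (v.adicCompletion ℚ)) W)) i))) =
      (PowerSeries.X : PowerSeries O) • fun i : Fin r => col ((locd₂ x).comp
        (AddMonoidHom.single (fun _ : Fin r => ↥(localTowerPointsOfEmb κ (closureEmb (K := ℚ) (v.adicCompletion ℚ)) W)) i)) := by
  funext i
  rw [Pi.smul_apply, smul_eq_mul]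
  exact col_locd₂_X_smul_single I W v hγ hg hP2 hlocd col hcol x i

end Glue

end Summit.BirchSwinnertonDyer.BirchSwinnertonDyer.Theorems.ThetaTransport

end
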